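import Literature.Geometry.Lorentzian.KillingFieldCurvatureIdentities
import Literature.Geometry.Lorentzian.Stationary
import Summits.FinalStateConjecture.FinalStateConjecture.Theorems.ZeroEnergyKerrOrBombHawkingExtensionIsKerrLocalZerothLawStar
import Summits.FinalStateConjecture.FinalStateConjecture.Theorems.ZeroEnergyKerrOrBombHawkingExtensionIsKerrHRSandwich
import HarnessLib

/-!
# Crux `HawkingExtensionIsKerr` (stmt-FinalStateConjecture-17840), line `SketchIdeator2` —
# programme NH, brick NH2: the second derivative of `g(K, K)` along an integral curve

Worker file of the line lead c5 (near-horizon sign analysis).  Abstract setting: a `C^∞`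
pseudo-Riemannian manifold with a GLOBAL Killing field `K`, a vector field `Y` smooth near the
point `p`, a curve `γ` through `p = γ 0` which near `t = 0` is an integral curve of `Y`, and the
DEGENERACY condition `∇_{K p} K = 0` at `p`.  With `f = g(K, K)`:

* `(Y f)(p) = df_p(Y p) = 2 g(∇_{Y p} K, K p) = -2 g(Y p, ∇_{K p} K) = 0`
  (`IsKillingField.mvfderiv_val_self_apply` and the Killing equation);
* near `t = 0`, `(f ∘ γ)' (t) = df_{γ t}(Y (γ t))` (chain rule along `γ`);
* `(t ↦ df_{γ t}(Y (γ t)))' (0) = 2 (g(R(Y p, K p) Y p, K p) + g(∇_{Y p} K, ∇_{Y p} K))`: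
  the function `y ↦ df_y(Y y) = 2 g(∇_{Y y} K, K y)` is differentiated along `Y p` with the
  compatibility of the Levi-Civita connection and O'Neill's Killing identity
  `∇_{Y p} ∇_Y K - ∇_{∇_{Y p} Y} K = R(Y p, K p) Y p` (O'Neill 1983, Ch. 9, Ex. 8,
  `IsKillingField.leviCivita₂_eq_riemann`), the term `g(∇_{∇_{Y p} Y} K, K p) =
  -g(∇_{Y p} Y, ∇_{K p} K)` vanishing by the Killing equation and degeneracy.

This is the bookkeeping behind the one-sided Taylor expansion of `g(K, K)` off a degenerate
Killing horizon (Wald 1984, §12.5; O'Neill 1983, Ch. 9, Ex. 8–9).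
-/

noncomputable section

set_option linter.dupNamespace false

namespace Summit.FinalStateConjecture.FinalStateConjecture.Theorems.HawkingExtensionIsKerr.SketchIdeator2

open Set Filter Bundle Function Literature.Geometry.Lorentzian
open scoped Manifold ContDiff Topology

section NH2

variable {E : Type*} [NormedAddCommGroup E] [NormedSpace ℝ E] [FiniteDimensional ℝ E]
  [CompleteSpace E] {H : Type*} [TopologicalSpace H] {I : ModelWithCorners ℝ E H}
  {M : Type*} [TopologicalSpace M] [ChartedSpace H M] [IsManifold I ∞ M]
  {g : PseudoRiemannianMetric I ∞ E (TangentSpace I : M → Type _)} [g.HasLeviCivita]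
  {K : Π x : M, TangentSpace I x}

omit [FiniteDimensional ℝ E] [CompleteSpace E] [IsManifold I ∞ M] [g.HasLeviCivita] in
/-- Chain rule along a curve with prescribed velocity: if `φ : M → ℝ` is differentiable at `γ t`
and `γ' (t) = v` (`hrSandwich_velocity_eq`), then `(φ ∘ γ)' (t) = dφ_{γ t}(v)` (with
Mathlib's `mvfderiv`; `hasDerivAt_comp_curve`). -/
theorem nh_hasDerivAt_comp_of_hasMFDerivAt {φ : M → ℝ} {γ : ℝ → M} {t : ℝ}
    {v : TangentSpace I (γ t)} (hφ : MDifferentiableAt I 𝓘(ℝ, ℝ) φ (γ t))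
    (hγ : HasMFDerivAt 𝓘(ℝ, ℝ) I γ t ((1 : ℝ →L[ℝ] ℝ).smulRight v)) :
    HasDerivAt (fun t' ↦ φ (γ t')) (mvfderiv I φ (γ t) v) t := by
  have h1 := hasDerivAt_comp_curve hφ hγ.mdifferentiableAt
  rw [hrSandwich_velocity_eq hγ] at h1
  exact h1

/-- **NH2, first derivative at a degenerate point.**  For a Killing field `K` with
`∇_{K p} K = 0`: `d(g(K,K))_p (v) = 2 g(∇_v K, K p) = -2 g(v, ∇_{K p} K) = 0` for every `v`. -/
theorem nh_mvfderiv_val_self_apply_eq_zero (hK : g.IsKillingField K) {p : M}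
    (hdeg : g.leviCivita K p (K p) = 0) (v : TangentSpace I p) :
    mvfderiv I (fun y ↦ g.val y (K y) (K y)) p v = 0 := by
  rw [hK.mvfderiv_val_self_apply p v]
  have hk := hK.val_leviCivita_add p v (K p)
  rw [hdeg, map_zero, add_zero] at hk
  rw [hk, mul_zero]

/-- **NH2, the derivative of `y ↦ d(g(K,K))_y (Y y)` at a degenerate point.**  For a Killing
field `K` of a smooth metric, a vector field `Y` smooth at `p`, and `∇_{K p} K = 0`:
`d(y ↦ d(g(K,K))_y (Y y))_p (Y p) = 2 (g(R(Y p, K p) Y p, K p) + g(∇_{Y p} K, ∇_{Y p} K))`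
(metric compatibility, O'Neill 1983, Ch. 9, Ex. 8, Killing equation and degeneracy). -/
theorem nh_mvfderiv_mvfderiv_val_self_apply (hK : g.IsKillingField K)
    {Y : Π x : M, TangentSpace I x} {p : M} (hY : CMDiffAt ∞ (T% Y) p)
    (hdeg : g.leviCivita K p (K p) = 0) :
    MDifferentiableAt I 𝓘(ℝ, ℝ) (fun y ↦ g.val y (g.leviCivita K y (Y y)) (K y)) p ∧
    mvfderiv I (fun y ↦ g.val y (g.leviCivita K y (Y y)) (K y)) p (Y p) =
      g.val p (g.riemann p (Y p) (K p) (Y p)) (K p)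
        + g.val p (g.leviCivita K p (Y p)) (g.leviCivita K p (Y p)) := by
  have hLC : g.IsLeviCivita g.leviCivita := PseudoRiemannianMetric.isLeviCivita_leviCivita_holds
  have h2 : (2 : ℕ∞ω) ≤ ∞ := ENat.LEInfty.out
  -- regularity
  have hA : CMDiffAt ∞ (T% (fun y ↦ g.leviCivita K y (Y y))) p :=
    contMDiffAt_leviCivita_apply_of_isKillingField hK hY
  have hYd : MDiffAt (T% Y) p := hY.mdifferentiableAt (by simp)
  have hKd : MDiffAt (T% K) p := hK.mdifferentiableAt p
  have hAd : MDiffAt (T% (fun y ↦ g.leviCivita K y (Y y))) p := hA.mdifferentiableAt (by simp)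
  have hd1 : MDiffAt (fun y ↦ g.val y (g.leviCivita K y (Y y)) (K y)) p :=
    g.mdifferentiableAt_val_apply hAd hKd
  refine ⟨hd1, ?_⟩
  -- compatibility of `∇`
  have hc1 : mvfderiv I (fun y ↦ g.val y (g.leviCivita K y (Y y)) (K y)) p (Y p) =
      g.val p (g.leviCivita (fun y ↦ g.leviCivita K y (Y y)) p (Y p)) (K p)
        + g.val p (g.leviCivita K p (Y p)) (g.leviCivita K p (Y p)) := hLC.2 hYd hAd hKd
  -- O'Neill Ch. 9 Ex. 8: `∇_{Y p} ∇_Y K = R(Y p, K p) Y p + ∇_{∇_{Y p} Y} K`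
  have h8 := hK.leviCivita₂_eq_riemann h2 hYd (Y p)
  have h8' : g.leviCivita (fun y ↦ g.leviCivita K y (Y y)) p (Y p) =
      g.riemann p (Y p) (K p) (Y p) + g.leviCivita K p (g.leviCivita Y p (Y p)) := by
    rw [← h8]; abel
  -- Killing equation and degeneracy: `g(∇_{∇_{Y p} Y} K, K p) = 0`
  have hk := hK.val_leviCivita_add p (g.leviCivita Y p (Y p)) (K p)
  rw [hdeg, map_zero, add_zero] at hk
  rw [hc1, h8', map_add, add_apply, hk, add_zero]

/-- **NH2 (general manifold form): the second derivative of `g(K, K)` along an integral curve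
through a degenerate point.**  Let `K` be a Killing field of the smooth metric `g`, `Y` a vector
field smooth near `p`, `γ` a curve with `γ 0 = p` which near `t = 0` has velocity `Y ∘ γ`, and
suppose `∇_{K p} K = 0`.  Then, with `f = g(K, K)`: `df_p (Y p) = 0`; near `t = 0`,
`(f ∘ γ)' (t) = df_{γ t}(Y (γ t))`; and `t ↦ df_{γ t}(Y (γ t))` has derivative
`2 (g(R(Y p, K p) Y p, K p) + g(∇_{Y p} K, ∇_{Y p} K))` at `t = 0`. -/
theorem nh_secondDerivative (hK : g.IsKillingField K) {Y : Π x : M, TangentSpace I x}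
    {γ : ℝ → M} {p : M}
    (hY : ∀ᶠ x in 𝓝 p, ContMDiffAt I (I.prod 𝓘(ℝ, E)) ∞
      (fun y ↦ (TotalSpace.mk' E y (Y y) : TangentBundle I M)) x)
    (h0 : γ 0 = p)
    (hγ : ∀ᶠ t in 𝓝 (0 : ℝ), HasMFDerivAt 𝓘(ℝ, ℝ) I γ t ((1 : ℝ →L[ℝ] ℝ).smulRight (Y (γ t))))
    (hdeg : g.leviCivita K p (K p) = 0) :
    mvfderiv I (fun y ↦ g.val y (K y) (K y)) p (Y p) = 0 ∧
    (∀ᶠ t in 𝓝 (0 : ℝ), HasDerivAt (fun t ↦ g.val (γ t) (K (γ t)) (K (γ t)))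
      (mvfderiv I (fun y ↦ g.val y (K y) (K y)) (γ t) (Y (γ t))) t) ∧
    HasDerivAt (fun t ↦ mvfderiv I (fun y ↦ g.val y (K y) (K y)) (γ t) (Y (γ t)))
      (2 * (g.val p (g.riemann p (Y p) (K p) (Y p)) (K p)
        + g.val p (g.leviCivita K p (Y p)) (g.leviCivita K p (Y p)))) 0 := by
  subst h0
  refine ⟨nh_mvfderiv_val_self_apply_eq_zero hK hdeg (Y (γ 0)), ?_, ?_⟩
  · -- chain rule along `γ` near `t = 0`
    filter_upwards [hγ] with t ht
    have hf : MDiffAt (fun y ↦ g.val y (K y) (K y)) (γ t) :=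
      g.mdifferentiableAt_val_apply (hK.mdifferentiableAt _) (hK.mdifferentiableAt _)
    exact nh_hasDerivAt_comp_of_hasMFDerivAt hf ht
  · -- `t ↦ df_{γ t}(Y (γ t)) = 2 g(∇_{Y (γ t)} K, K (γ t))`, differentiated at `t = 0`
    have hfun : (fun t ↦ mvfderiv I (fun y ↦ g.val y (K y) (K y)) (γ t) (Y (γ t))) =
        fun t ↦ 2 * g.val (γ t) (g.leviCivita K (γ t) (Y (γ t))) (K (γ t)) :=
      funext fun t ↦ hK.mvfderiv_val_self_apply (γ t) (Y (γ t))
    rw [hfun]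
    obtain ⟨hd1, hD⟩ := nh_mvfderiv_mvfderiv_val_self_apply hK hY.self_of_nhds hdeg
    have hG := nh_hasDerivAt_comp_of_hasMFDerivAt hd1 hγ.self_of_nhds
    rw [hD] at hG
    exact hG.const_mul 2

end NH2

/-- **Registered sub-goal form of NH2** (closed statement over `E4`-charted manifolds, crux
stmt-FinalStateConjecture-17840, line `SketchIdeator2`): the second derivative of `g(K, K)`
along an integral curve of a smooth field `Y` through a degenerate point `p` of the Killing
field `K`. -/
theorem stub_nh_secondDerivative : ∀ (M : Type) [TopologicalSpace M] [ChartedSpace E4 M] [IsManifold (𝓡 4) ∞ M] (g : PseudoRiemannianMetric (𝓡 4) ∞ E4 (TangentSpace (𝓡 4) : M → Type _)) [g.HasLeviCivita] (K Y : Π x : M, TangentSpace (𝓡 4) x) (γ : ℝ → M) (p : M), g.IsKillingField K → (∀ᶠ x in 𝓝 p, ContMDiffAt (𝓡 4) ((𝓡 4).prod 𝓘(ℝ, E4)) ∞ (fun y ↦ (Bundle.TotalSpace.mk' E4 y (Y y) : TangentBundle (𝓡 4) M)) x) → γ 0 = p → (∀ᶠ t in 𝓝 (0 : ℝ), HasMFDerivAt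 𝓘(ℝ, ℝ) (𝓡 4) γ t ((1 : ℝ →L[ℝ] ℝ).smulRight (Y (γ t)))) → g.leviCivita K p (K p) = 0 → mvfderiv (𝓡 4) (fun y ↦ g.val y (K y) (K y)) p (Y p) = 0 ∧ (∀ᶠ t in 𝓝 (0 : ℝ), HasDerivAt (fun t ↦ g.val (γ t) (K (γ t)) (K (γ t))) (mvfderiv (𝓡 4) (fun y ↦ g.val y (K y) (K y)) (γ t) (Y (γ t))) t) ∧ HasDerivAt (fun t ↦ mvfderiv (𝓡 4) (fun y ↦ g.val y (K y) (K y)) (γ t) (Y (γ t))) (2 * (g.val p (g.riemann p (Y p) (K p) (Y p)) (K p) + g.val p (g.leviCivita K p (Y p)) (g.leviCivita K p (Y p)))) 0 :=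
  fun _ _ _ _ _ _ _ _ _ _ hK hY h0 hγ hdeg ↦ nh_secondDerivative hK hY h0 hγ hdeg

end Summit.FinalStateConjecture.FinalStateConjecture.Theorems.HawkingExtensionIsKerr.SketchIdeator2

end
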